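import Literature.Topology.FourManifolds.KirbyMovesSlideTransport
import Literature.Topology.FourManifolds.LickorishTwistLink
import HarnessLib

/-!
# Tubes through a surgery: compactness of the surgered manifold and pulling a transported tube back to `S³`

Topic `Literature/Topology/FourManifolds`; fact seat
`provefact-Literature.Topology.FourManifolds.FramedLink.IsStrictHandleSlide.slideModel`
(Kirby, *The Topology of 4-Manifolds* (1989), Ch. I §4), infrastructure for the open leaf (S₁ᵃ)
`FramedLink.IsStrictHandleSlide.slideDiffeoAligned` (`KirbyMovesSlideAlign.lean`). The slide is
an ambient isotopy `Ψ` of the surgered manifold `Yⱼ = (S³ ∖ Kⱼ) ∪_φ,ψ (D̊² × S¹)` carrying the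
attaching circle `φ ∘ Kᵢ` to `φ ∘ Kᵢ'`; (S₁ᵃ) asks for oriented tubular neighbourhoods `μᵢ` of `Kᵢ`
and `μᵢ'` of `Kᵢ'` **in `S³`** with `Ψ₁ ∘ φ ∘ μᵢ = φ ∘ μᵢ'`. This file provides the two general
tools for that step; everything here is proved.

* `Literature.Topology.FourManifolds.compactSpace_of_presentation` — **the surgered manifold is
  compact**: it is covered by `φ(S³ ∖ ν(S¹ × D̊²_{1/2}))` and `ψ(D̄²_{1/2} × S¹)` (the gluing
  `φ (ν (u, t v)) = ψ (t u, v)` puts every other point in one of them). Needed to apply the tree's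
  isotopy extension theorems (`exists_ambientIsotopy_comp_eq_rel`, `IsotopyExtensionRel.lean`),
  which are stated for compact targets. Rolfsen, *Knots and Links* (1976), §9.F.
* `Literature.Topology.FourManifolds.Knot.TubularNbhd.exists_pullback` — **pulling a transported
  tube back to `S³`.** Let `φ : S³ ∖ K ↪ Y` be an open smooth embedding (a chart of the surgered
  manifold), `Φ` a diffeomorphism of `Y`, `μ` an oriented tubular neighbourhood of a knot `A`
  missing `K` with `Φ(φ(μ(S¹ × ℝ²))) ⊆ φ(S³ ∖ K)` and `Φ ∘ φ ∘ A = φ ∘ A₁` for a knot `A₁`. If `Φ`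
  **fixes `φ ∘ μ` on a nonempty open set** then `φ⁻¹ ∘ Φ ∘ φ ∘ μ` is an oriented tubular
  neighbourhood `μ₁` of `A₁` (so `Φ ∘ φ ∘ μ = φ ∘ μ₁`). Smoothness: a composite of open smooth
  embeddings and the inverse chart (`isSmoothEmbedding_of_openPartialHomeomorph`,
  `isSmoothEmbedding_comp_of_isOpen_range`). **Orientation without an orientation of `Y`**: the
  Jacobian frame determinant of the composite never vanishes (`tubeFrameDet_coordOf_ne_zero`, it is
  a local diffeomorphism `S¹ × ℝ² → S³`, `LickorishTwist.isLocalDiffeomorph_of_tube`), hence has constant sign on the connected `ℝ × ℝ²`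
  (`tubeFrameDet_coordOf_pos_or_neg`, `TubularNbhdOfLocalDiffeomorph.lean`), and on the open set
  where `Φ = id` it *is* the frame determinant of `μ`, which is positive. (In the slide, `Ψ` is the
  identity near a point of `Kᵢ` far from the band — the relative isotopy extension theorem — which
  is where the hypothesis comes from.) Hirsch, *Differential Topology* (1976), Ch. 4 §5 (tubular
  neighbourhoods and the orientation of the normal bundle), Ch. 8 §1 Thm. 1.3.

## References

* R. C. Kirby, *The Topology of 4-Manifolds*, LNM 1374, Springer (1989), Ch. I §4. [Kirby1989]
* D. Rolfsen, *Knots and Links*, Publish or Perish (1976), §9.F. [Rolfsen1976]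
* M. W. Hirsch, *Differential Topology*, GTM 33, Springer (1976), Ch. 4 §5; Ch. 8 §1, Thm. 1.3.
  [HirschDT1976]
-/

open scoped Manifold ContDiff Topology
open Function Set

noncomputable section

namespace Literature.Topology.FourManifolds

/-- Local notation: `𝔼 n` is the model Euclidean space `EuclideanSpace ℝ (Fin n)`. -/
local notation "𝔼 " n:arg => EuclideanSpace ℝ (Fin n)

/-- Local notation: `𝕊 n` is the unit sphere in `EuclideanSpace ℝ (Fin (n + 1))`. -/
local notation "𝕊 " n:arg => (Metric.sphere (0 : EuclideanSpace ℝ (Fin (n + 1))) 1)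

attribute [local instance] fact_finrank_euclideanSpace_succ

/-! ## The surgered manifold is compact -/

section Compact

variable {K : Knot} (ν : Knot.TubularNbhd K) {Y : Type*} [TopologicalSpace Y]
  {φ : K.complement → Y} {ψ : solidTorus → Y}

/-- **The surgered manifold is compact.** If `Y` is the open gluing of `S³ ∖ K` and the open solid
torus `D̊² × S¹` along the surgery relation of the tube `ν` (`φ (ν (u, t v)) = ψ (t u, v)`,
`0 < t < 1`, and `Y = φ(S³ ∖ K) ∪ ψ(D̊² × S¹)`), then `Y` is compact: it is the union of the images
of the compact sets `S³ ∖ ν(S¹ × D̊²_{1/2})` and `D̄²_{1/2} × S¹`. Rolfsen (1976), §9.F.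
[cite: Rolfsen1976, §9.F] -/
theorem compactSpace_of_presentation (hφc : Continuous φ) (hψc : Continuous ψ)
    (hcov : range φ ∪ range ψ = univ) (hrel : ∀ a c, φ a = ψ c ↔ surgeryRel ν a c) :
    CompactSpace Y := by
  -- the two compact pieces
  set W : Set (𝕊 3) := ⇑ν '' (univ ×ˢ Metric.ball (0 : 𝔼 2) (1 / 2)) with hW
  have hWo : IsOpen W := ν.isOpen_image (isOpen_univ.prod Metric.isOpen_ball)
  set A : Set K.complement := {a | (a : 𝕊 3) ∉ W} with hA
  set B : Set solidTorus := {c | ‖(c : (𝔼 2) × (𝕊 1)).1‖ ≤ 1 / 2} with hB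
  have hAc : IsCompact A := by
    refine Topology.IsInducing.subtypeVal.isCompact_iff.2 ?_
    convert hWo.isClosed_compl.isCompact using 1
    ext y
    constructor
    · rintro ⟨a, ha, rfl⟩; exact ha
    · intro hy
      refine ⟨⟨y, ?_⟩, hy, rfl⟩
      rw [SetLike.mem_coe, SphereEmbedding.mem_complement_iff]
      rintro ⟨x, rfl⟩
      exact hy ⟨(x, 0), ⟨mem_univ _, Metric.mem_ball_self (by norm_num)⟩, ν.coe_apply_zero x⟩
  have hBc : IsCompact B := by
    refine Topology.IsInducing.subtypeVal.isCompact_iff.2 ?_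
    convert (isCompact_closedBall (0 : 𝔼 2) (1 / 2)).prod (isCompact_univ (X := 𝕊 1)) using 1
    ext p
    simp only [mem_image, mem_prod, Metric.mem_closedBall, dist_zero_right, mem_univ, and_true]
    constructor
    · rintro ⟨c, hc, rfl⟩; exact hc
    · intro hp
      exact ⟨⟨p, (mem_solidTorus_iff p).2 (by linarith)⟩, hp, rfl⟩
  -- they cover
  have hsub : (univ : Set Y) ⊆ φ '' A ∪ ψ '' B := by
    intro y _
    -- a point `ν (u, w)` of the thin tube, `w ≠ 0`, is glued to `(‖w‖ u, w/‖w‖)`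
    have hthin : ∀ a : K.complement, (a : 𝕊 3) ∈ W → φ a ∈ ψ '' B := by
      rintro a ⟨⟨u, w⟩, ⟨-, hw⟩, ha⟩
      rw [Metric.mem_ball, dist_zero_right] at hw
      have hw0 : w ≠ 0 := by
        rintro rfl
        exact ((SphereEmbedding.mem_complement_iff K (a : 𝕊 3)).1 a.2)
          ⟨u, by rw [← ha, ν.coe_apply_zero]⟩
      have hwpos : 0 < ‖w‖ := norm_pos_iff.2 hw0
      set c : solidTorus := ⟨(‖w‖ • (u : 𝔼 2), radialProjection (spherePt 1) w),
        (mem_solidTorus_iff _).2 (by rw [norm_smul_coe_sphere hwpos.le]; linarith)⟩ with hc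
      refine ⟨c, ?_, ?_⟩
      · change ‖‖w‖ • (u : 𝔼 2)‖ ≤ 1 / 2
        rw [norm_smul_coe_sphere hwpos.le]; exact hw.le
      · rw [eq_comm, hrel]
        refine ⟨u, ‖w‖, ⟨hwpos, by linarith⟩, rfl, ?_⟩
        rw [← ha, norm_smul_coe_radialProjection]
    have hy : y ∈ range φ ∪ range ψ := by rw [hcov]; exact mem_univ y
    rcases hy with ⟨a, rfl⟩ | ⟨c, rfl⟩
    · by_cases ha : (a : 𝕊 3) ∈ W
      · exact Or.inr (hthin a ha)
      · exact Or.inl ⟨a, ha, rfl⟩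
    · by_cases hc : ‖(c : (𝔼 2) × (𝕊 1)).1‖ ≤ 1 / 2
      · exact Or.inr ⟨c, hc, rfl⟩
      · -- `ψ (p, v)` with `1/2 < ‖p‖ < 1` is `φ (ν (p/‖p‖, ‖p‖ v))`, a point off the thin tube
        rw [not_le] at hc
        set p : 𝔼 2 := (c : (𝔼 2) × (𝕊 1)).1 with hp
        set v : 𝕊 1 := (c : (𝔼 2) × (𝕊 1)).2 with hv
        have hp1' : ‖p‖ < 1 := (mem_solidTorus_iff (c : (𝔼 2) × (𝕊 1))).1 c.2
        have hp0 : p ≠ 0 := fun h ↦ by rw [h, norm_zero] at hc; linarith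
        set u : 𝕊 1 := radialProjection (spherePt 1) p with hu
        have hpu : p = ‖p‖ • (u : 𝔼 2) := (norm_smul_coe_radialProjection _ p).symm
        set a : K.complement := ⟨ν (u, ‖p‖ • (v : 𝔼 2)), ν.apply_mem_compl_range
          (smul_ne_zero (norm_ne_zero_iff.2 hp0) (ne_zero_of_mem_unit_sphere v))⟩ with ha
        have hglue : φ a = ψ c := by
          rw [hrel]
          exact ⟨u, ‖p‖, ⟨norm_pos_iff.2 hp0, hp1'⟩, hpu, rfl⟩
        refine Or.inl ⟨a, ?_, hglue⟩
        rintro ⟨⟨u', w'⟩, ⟨-, hw'⟩, hq⟩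
        rw [Metric.mem_ball, dist_zero_right] at hw'
        have := congrArg Prod.snd (ν.injective hq)
        simp only at this
        rw [this, norm_smul_coe_sphere (norm_nonneg _)] at hw'
        linarith
  exact ⟨(((hAc.image hφc).union (hBc.image hψc)).of_isClosed_subset isClosed_univ hsub)⟩

end Compact

/-! ## Pulling a transported tube back to `S³` -/

section Pullback

variable {K : Knot} {Y : Type*} [TopologicalSpace Y] [ChartedSpace (𝔼 3) Y] [IsManifold (𝓡 3) ∞ Y]
  {φ : K.complement → Y}

/-- **Pulling a transported tube back to `S³`.** Let `φ : S³ ∖ K → Y` be an open smooth embedding,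
`Φ` a diffeomorphism of `Y`, `μ` an oriented tubular neighbourhood of the knot `A` missing `K`,
such that `Φ (φ (μ q)) ∈ φ(S³ ∖ K)` for all `q`, `Φ (φ (A x)) = φ (A₁ x)` for a knot `A₁` off `K`,
and `Φ (φ (μ q)) = φ (μ q)` on a nonempty open set `U`. Then there is an oriented tubular
neighbourhood `μ₁` of `A₁`, missing `K`, with `φ ∘ μ₁ = Φ ∘ φ ∘ μ` (and `μ₁ = μ` on `U`): the map
`φ⁻¹ ∘ Φ ∘ φ ∘ μ` is an open smooth embedding `S¹ × ℝ² ↪ S³` extending `A₁`, and its Jacobian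
frame determinant, nowhere zero and of constant sign, agrees on `U` with that of `μ`, which is
positive. Hirsch (1976), Ch. 4 §5. [cite: HirschDT1976, Ch. 8 §1, Thm. 1.3] -/
theorem Knot.TubularNbhd.exists_pullback (hφ : Manifold.IsSmoothEmbedding (𝓡 3) (𝓡 3) ∞ φ)
    (hφo : IsOpen (range φ)) (Φ : Y ≃ₘ⟮𝓡 3, 𝓡 3⟯ Y) {A A₁ : Knot} (μ : Knot.TubularNbhd A)
    (hμK : ∀ q, μ q ∈ K.complement) (hA₁K : ∀ x, A₁ x ∈ K.complement)
    (hΦA : ∀ x, Φ (φ ⟨μ (x, 0), hμK (x, 0)⟩) = φ ⟨A₁ x, hA₁K x⟩)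
    (hin : ∀ q, Φ (φ ⟨μ q, hμK q⟩) ∈ range φ)
    {U : Set ((𝕊 1) × (𝔼 2))} (hU : IsOpen U) (hUne : U.Nonempty)
    (hfix : ∀ q ∈ U, Φ (φ ⟨μ q, hμK q⟩) = φ ⟨μ q, hμK q⟩) :
    ∃ μ₁ : Knot.TubularNbhd A₁, (∀ q, ∃ h₁ : μ₁ q ∈ K.complement,
      φ ⟨μ₁ q, h₁⟩ = Φ (φ ⟨μ q, hμK q⟩)) ∧ ∀ q ∈ U, μ₁ q = μ q := by
  haveI : Nonempty ((𝕊 1) × (𝔼 2)) := ⟨hUne.some⟩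
  haveI : Nonempty K.complement := ⟨⟨μ hUne.some, hμK _⟩⟩
  have hφe : Topology.IsOpenEmbedding φ := Topology.IsOpenEmbedding.mk hφ.isEmbedding hφo
  set φH := hφe.toOpenPartialHomeomorph φ with hφH
  have hφH_apply : ⇑φH = φ := hφe.toOpenPartialHomeomorph_apply _
  have hφH_src : φH.source = univ := hφe.toOpenPartialHomeomorph_source _
  have hφH_tgt : φH.target = range φ := hφe.toOpenPartialHomeomorph_target _
  -- `μ` with values in the complement, and the transported tube `g = Φ ∘ φ ∘ μ` in `Y`
  set μc : (𝕊 1) × (𝔼 2) → K.complement := fun q ↦ ⟨μ q, hμK q⟩ with hμc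
  obtain ⟨hμcemb, hμco⟩ := isSmoothEmbedding_codRestrict_opens μ.isSmoothEmbedding_coe
    μ.isOpen_range K.complement hμK modelIso₁₂
  obtain ⟨hφμ, hφμo⟩ := isSmoothEmbedding_comp_of_isOpen_range hφ hφo hμcemb hμco modelIso₁₂
  set g : (𝕊 1) × (𝔼 2) → Y := ⇑Φ ∘ (φ ∘ μc) with hg
  have hgemb : Manifold.IsSmoothEmbedding ((𝓡 1).prod 𝓘(ℝ, 𝔼 2)) (𝓡 3) ∞ g :=
    hφμ.diffeomorph_comp Φ
  have hgo : IsOpen (range g) := by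
    rw [hg, range_comp]
    have := Φ.toHomeomorph.isOpenMap _ hφμo
    rwa [Diffeomorph.coe_toHomeomorph] at this
  have hge : Topology.IsOpenEmbedding g := Topology.IsOpenEmbedding.mk hgemb.isEmbedding hgo
  set gH := hge.toOpenPartialHomeomorph g with hgH
  have hgH_apply : ⇑gH = g := hge.toOpenPartialHomeomorph_apply _
  have hgH_src : gH.source = univ := hge.toOpenPartialHomeomorph_source _
  have hgH_tgt : gH.target = range g := hge.toOpenPartialHomeomorph_target _
  -- the pulled-back tube as a partial homeomorphism `Θ = φ⁻¹ ∘ g` into the complement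
  set Θ := gH.trans φH.symm with hΘ
  have hΘ_apply : ∀ q, Θ q = φH.symm (g q) := fun q ↦ by
    rw [hΘ, OpenPartialHomeomorph.coe_trans, comp_apply, hgH_apply]
  have hΘ_src : Θ.source = univ := by
    rw [hΘ, OpenPartialHomeomorph.trans_source, hgH_src, univ_inter, OpenPartialHomeomorph.symm_source,
      hφH_tgt, eq_univ_iff_forall]
    intro q
    rw [mem_preimage, hgH_apply]
    exact hin q
  have h1 : ContMDiffOn ((𝓡 1).prod 𝓘(ℝ, 𝔼 2)) (𝓡 3) ∞ Θ Θ.source := by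
    rw [hΘ_src]
    have : (Θ : (𝕊 1) × (𝔼 2) → K.complement) = φH.symm ∘ g := funext hΘ_apply
    rw [this]
    refine ((contMDiffOn_symm_of_isSmoothEmbedding hφ hφe).comp hgemb.contMDiff.contMDiffOn
      fun q _ ↦ ?_)
    exact hin q
  have h2 : ContMDiffOn (𝓡 3) ((𝓡 1).prod 𝓘(ℝ, 𝔼 2)) ∞ Θ.symm Θ.target := by
    have hsymm : (Θ.symm : K.complement → (𝕊 1) × (𝔼 2)) = gH.symm ∘ φ := by
      rw [hΘ, OpenPartialHomeomorph.trans_symm_eq_symm_trans_symm, OpenPartialHomeomorph.symm_symm,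
        OpenPartialHomeomorph.coe_trans, hφH_apply]
    have htgt : Θ.target ⊆ φ ⁻¹' range g := by
      rw [hΘ, OpenPartialHomeomorph.trans_target]
      rintro a ⟨-, ha⟩
      rw [mem_preimage, OpenPartialHomeomorph.symm_symm, hφH_apply, hgH_tgt] at ha
      exact ha
    rw [hsymm]
    exact (contMDiffOn_symm_of_isSmoothEmbedding hgemb hge).comp hφ.contMDiff.contMDiffOn
      fun a ha ↦ htgt ha
  have hΘemb : Manifold.IsSmoothEmbedding ((𝓡 1).prod 𝓘(ℝ, 𝔼 2)) (𝓡 3) ∞ Θ :=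
    isSmoothEmbedding_of_openPartialHomeomorph Θ hΘ_src h1 h2 modelIso₁₂
  have hΘo : IsOpen (range (Θ : (𝕊 1) × (𝔼 2) → K.complement)) := by
    rw [← image_univ, ← hΘ_src, Θ.image_source_eq_target]
    exact Θ.open_target
  -- the tube in `S³`
  set f : (𝕊 1) × (𝔼 2) → 𝕊 3 := Subtype.val ∘ Θ with hf
  obtain ⟨hfemb, -⟩ := isSmoothEmbedding_comp_of_isOpen_range
    (Manifold.IsSmoothEmbedding.of_opens K.complement) (by rw [Subtype.range_coe]; exact K.complement.isOpen)
    hΘemb hΘo modelIso₁₂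
  have hloc : IsLocalDiffeomorph ((𝓡 1).prod 𝓘(ℝ, 𝔼 2)) (𝓡 3) ∞ f := LickorishTwist.isLocalDiffeomorph_of_tube hfemb
  -- `φ ∘ Θ = g`
  have hφΘ : ∀ q, φ (Θ q) = g q := fun q ↦ by
    rw [hΘ_apply, ← hφH_apply]
    exact φH.right_inv (by rw [hφH_tgt]; exact hin q)
  -- zero section
  have hf0 : ∀ x, f (x, 0) = A₁ x := fun x ↦ by
    have h := hφΘ (x, 0)
    rw [hg, comp_apply, comp_apply, hΦA x] at h
    exact congrArg Subtype.val (hφ.isEmbedding.injective h)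
  -- agreement with `μ` on `U`
  have hfU : ∀ q ∈ U, f q = μ q := fun q hq ↦ by
    have h := hφΘ q
    rw [hg, comp_apply, comp_apply, hfix q hq] at h
    exact congrArg Subtype.val (hφ.isEmbedding.injective h)
  -- orientation: the frame determinant is positive on `U`, hence everywhere
  have hpos : ∀ q, 0 < tubeFrameDet (coordOf f) q := by
    obtain ⟨⟨x₀, w₀⟩, hq₀⟩ := hUne
    obtain ⟨θ₀, rfl⟩ := circlePoint_surjective x₀
    have hev : coordOf f =ᶠ[𝓝 (θ₀, w₀)] coordOf ⇑μ := by
      have hpre : angleParam ⁻¹' U ∈ 𝓝 (θ₀, w₀) :=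
        (hU.preimage contMDiff_angleParam.continuous).mem_nhds hq₀
      filter_upwards [hpre] with q hq
      simp only [coordOf, hfU _ hq]
    have h0 : 0 < tubeFrameDet (coordOf f) (θ₀, w₀) := by
      rw [tubeFrameDet_def, hev.fderiv_eq, hev.eq_of_nhds, ← tubeFrameDet_def]
      exact μ.tubeFrameDet_paramCoe_pos (θ₀, w₀)
    rcases tubeFrameDet_coordOf_pos_or_neg hloc with h | h
    · exact h
    · exact absurd (h (θ₀, w₀)) (not_lt.2 h0.le)
  refine ⟨Knot.TubularNbhd.ofPos hloc hfemb.isEmbedding.injective hf0 hpos, fun q ↦ ⟨(Θ q).2, ?_⟩,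
    fun q hq ↦ ?_⟩
  · change φ ⟨(Θ q : 𝕊 3), (Θ q).2⟩ = Φ (φ (μc q))
    rw [Subtype.coe_eta]
    exact hφΘ q
  · exact hfU q hq

end Pullback

end Literature.Topology.FourManifolds
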